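import Summits.KontsevichZagierPeriods.KontsevichZagierPeriods.Theorems.SymplecticScissorsRealOnePeriodRelationsStubTorsUnitAssembly
import Summits.KontsevichZagierPeriods.KontsevichZagierPeriods.Theorems.SymplecticScissorsRealOnePeriodRelationsStubTorsPolyExists
import Summits.KontsevichZagierPeriods.KontsevichZagierPeriods.Theorems.SymplecticScissorsRealOnePeriodRelationsStubEllipticLiouville

/-!
# Crux `RealOnePeriodRelations` (stmt-KontsevichZagierPeriods-10042), line `nash-retraction-thin-strip`, reshape 10:
# the registered stub `stub_torsUnit` (lead) — the torsion units `G_±` and the dlog identity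

`stub_torsUnit` = `torsUnit_of` (`…StubTorsUnitAssembly.lean`) fed with the landed worker stubs `stub_torsPolyExists`
(the polynomial with the divisor of the `σ`-quotient, by linear algebra over `ℚ̄`) and `stub_ellipticLiouville` (a `Λ`-periodic
meromorphic function with at most one simple pole per period class is constant).  For an algebraic torsion point `v` of `E_L`
(`N v ∈ Λ`, `2v ∉ Λ`) it yields `G₊, G₋ ∈ ℚ̄[x, y]` with `G₊ G₋ = c (℘ − ℘ v)^N` along `φ` (`c ∈ ℚ̄ˣ`) and
`dlog G₊ − dlog G₋ = N ℘′(v)/(℘ − ℘ v) − 2λ` with `λ = N ζ(v) − η(N v) ∈ ℚ̄` — the functions of divisor `N(±P) − N(O)` whose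
existence is equivalent to `P` being torsion (Abel), obtained here without divisor theory.
[cite: WhittakerWatson1927, §20.53] [cite: SilvermanAEC2009, III.3.5] [cite: HuberWustholz2022, §18.1]
-/

noncomputable section

open scoped BigOperators Topology PeriodPair
open Set Filter MvPolynomial Complex
open Literature.NumberTheory.Transcendental Literature.NumberTheory.Transcendental.CurvePeriods
open Literature.NumberTheory.Transcendental.CurvePeriods.Ell

namespace Summit.KontsevichZagierPeriods.SymplecticScissors.RealOnePeriodRelations

namespace TorsionLayer

/-- STUB `stub_torsUnit` (lead) — **the torsion units and the dlog identity.**  For an algebraic torsion point `v`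
(`N v ∈ Λ`, `2v ∉ Λ`) there are `G₊, G₋ ∈ ℚ̄[x, y]` (of divisors `N(±P) − N(O)`) with `G₊ G₋ = c (x − ℘ v)^N` on `E_L`
(`c ∈ ℚ̄ˣ`) and `dlog G₊ − dlog G₋ = (N ℘′(v)/(℘ − ℘ v) − 2λ) dz` along `φ`, `λ = N ζ(v) − η(Nv) ∈ ℚ̄`: the polynomial of
`stub_torsPolyExists` is `const · (σ(u − v)/σ(u))^N e^{η(Nv) u}` by `stub_ellipticLiouville`, and
`ζ(u − v) − ζ(u + v) = ℘′(v)/(℘ u − ℘ v) − 2ζ(v)`. [cite: WhittakerWatson1927, §20.42, §20.421, §20.53] -/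
theorem stub_torsUnit (L : PeriodPair) (h₂ : IsAlgebraic ℚ L.g₂) (h₃ : IsAlgebraic ℚ L.g₃)
    {v : ℂ} (hv : IsAlgPt L v) {N : ℕ} (hN : 1 ≤ N) (hNv : (N : ℂ) * v ∈ L.lattice) (h2v : 2 * v ∉ L.lattice) :
    ∃ (Gp Gm : MvPolynomial (Fin 2) ℂ) (c lam : ℂ), HasAlgCoeffs Gp ∧ HasAlgCoeffs Gm ∧
      IsAlgebraic ℚ c ∧ c ≠ 0 ∧ IsAlgebraic ℚ lam ∧
      (∀ z : ℂ, z ∉ L.lattice → eval (phi L z) Gp * eval (phi L z) Gm = c * (℘[L] z - ℘[L] v) ^ N) ∧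
      (∀ z : ℂ, z ∉ L.lattice → ℘[L] z ≠ ℘[L] v →
        (∑ k, eval (phi L z) (pderiv k Gp) * phiD L z k) / eval (phi L z) Gp -
          (∑ k, eval (phi L z) (pderiv k Gm) * phiD L z k) / eval (phi L z) Gm =
            (N : ℂ) * ℘'[L] v / (℘[L] z - ℘[L] v) - 2 * lam) :=
  torsUnit_of L h₂ h₃ (fun hw _ hM => stub_torsPolyExists L h₂ h₃ hw hM)
    (fun w hw r => stub_ellipticLiouville L w hw r) hv hN hNv h2v

end TorsionLayer

end Summit.KontsevichZagierPeriods.SymplecticScissors.RealOnePeriodRelations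

end
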